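import Mathlib
import Summits.SmoothPoincare4.SmoothPoincare4.Theses.CylinderEntropy
import Summits.SmoothPoincare4.SmoothPoincare4.Theses.EntropyLadder
import Literature.Geometry.Riemannian.SphericalCylinderEntropy
import Literature.Geometry.Manifold.CylinderSlice
import Literature.Topology.FourManifolds.CerfGammaFourProofs

/-!
# Sketch — crux-plan for idea `quantised-width-reduction` on crux stmt-SmoothPoincare4-7633
(`CylinderEntropy.ThinCrossSectionExists` = E), planner seat
`planner-cruxplan-stmt-SmoothPoincare4-7633-quantised-width-redu-0`, 2026-08-16.

Purpose of this file: tree-visible, kernel-checked text of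
(1) the idea's four "first lemmas" as typed statements over existing declarations — `UpperWidth` (U₃),
    `UpperWidthTwo` (numerical corollary, PROVED from `UpperWidth`), `PresentationWidth` (U₂), `SliceThin`
    (PROVED from the support item `SliceCalibration`);
(2) the idea's concluding composition `E_of : B → T → SliceThin → E` and the COSTUME demonstration: it factors,
    definitionally, as `crux_of_spc4 ∘ spc4_of_bounds_of_standard` — every use of `B` and `T` passes through the
    summit statement `SmoothPoincare4` (`E_of_eq`);
(3) the best non-literal skeleton the idea admits, `E_of_presentationWidth : B → U₂ → NoBubbleSheetValue → E`, and
    the proof that its one non-constructive stub `NoBubbleSheetValue` ("μ never equals the bubble-sheet value") is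
    `PresentationSpheresStandard` modulo the route's own recognition crux `CylinderRungTwo` and U₂
    (`standard_of_noBubbleSheetValue`), i.e. EntropyLadder's rank-2 crux stmt-SmoothPoincare4-3717 in entropy costume.
No stub is registered from this file; it is evidence for the NO-SKELETON verdict of `Lines/quantised-width-reduction.md`.
-/

noncomputable section

-- the registered namespace `Summit.SmoothPoincare4.SmoothPoincare4.…` repeats a component
set_option linter.dupNamespace false

open scoped BigOperators Topology Manifold MeasureTheory ENNReal NNReal ContDiff ContinuousMap
open Filter Set Function TopologicalSpace MeasureTheory
open Literature.Geometry.Riemannian.SphericalCylinderEntropy (cylEntropy one_le_cylEntropy_slice)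
open Literature.Geometry.Manifold.CylinderSlice (sliceMap range_sliceMap isSmoothEmbedding_sliceMap
  sum_sq_sliceMap separatesEnds_of_slice_subset sliceMap_apply_last)

namespace Summit.SmoothPoincare4.SmoothPoincare4.Cruxes.ThinCrossSectionExists.QuantisedWidthReduction

open Summit.SmoothPoincare4.SmoothPoincare4.Theses.CylinderEntropy (ThinCrossSectionExists CylinderRungTwo
  SliceCalibration SliceIsolation)
open Summit.SmoothPoincare4.SmoothPoincare4.Theses.EntropyLadder (BoundsContractibleTwoHandlebody
  PresentationSpheresStandard)

local notation "E⁶" => EuclideanSpace ℝ (Fin 6)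
local notation "E⁵" => EuclideanSpace ℝ (Fin 5)
local notation "E⁴" => EuclideanSpace ℝ (Fin 4)
local notation "𝕊⁴" => (Metric.sphere (0 : EuclideanSpace ℝ (Fin 5)) 1)

/-! ## §0 The crux through named pieces (verbatim abbreviations, checked by `Iff.rfl`) -/

/-- `z ∈ N = S⁴×ℝ ⊂ ℝ⁶`, literally as in the items. -/
def InN (z : E⁶) : Prop := ∑ i : Fin 5, z (Fin.castSucc i) ^ 2 = 1

/-- "separates the two ends of `N`", literally as in the items. -/
def Separates (A : Set E⁶) : Prop :=
  ∃ R : ℝ, ∀ a b : E⁶, InN a → InN b → a 5 ≤ -R → R ≤ b 5 → ¬ JoinedIn ({z : E⁶ | InN z} \ A) a b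

/-- `M` has an end-separating smooth cross-section embedding into `N` of typed cylinder entropy `< c`. -/
def CrossSectionBelow (c : ℝ≥0∞) (M : Type) [TopologicalSpace M] [ChartedSpace E⁴ M] : Prop :=
  ∃ ι : M → E⁶, Manifold.IsSmoothEmbedding (𝓡 4) (𝓡 6) ∞ ι ∧ (∀ x, InN (ι x)) ∧
    Separates (Set.range ι) ∧ cylEntropy (Set.range ι) < c

/-- E with a variable threshold. -/
def ThinAtLevel (c : ℝ≥0∞) : Prop :=
  ∀ (M : Type) [TopologicalSpace M] [T2Space M] [SecondCountableTopology M]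
    [ChartedSpace E⁴ M] [IsManifold (𝓡 4) ∞ M], M ≃ₕ 𝕊⁴ → CrossSectionBelow c M

/-- The bubble-sheet value `λ(S²×ℝ²) = 4/e` and the next rung `λ(S¹×ℝ³) = √(2π/e)` (Stone 1994), as typed. -/
def levelTwo : ℝ≥0∞ := ENNReal.ofReal (4 / Real.exp 1)
def levelThree : ℝ≥0∞ := ENNReal.ofReal (Real.sqrt (2 * Real.pi / Real.exp 1))

/-- The crux E is literally `ThinAtLevel (4/e)`. -/
theorem crux_iff : ThinCrossSectionExists ↔ ThinAtLevel levelTwo := Iff.rfl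

/-- EntropyLadder's interface `Bounds₂ M` (verbatim shape of items 3717/3720/3721): `M` bounds a compact
contractible smooth 5-manifold with an adapted Morse function of index `≤ 2` (a presentation sphere when
`M ≃ₕ S⁴`). -/
def Bounds₂ (M : Type) [TopologicalSpace M] [ChartedSpace E⁴ M] : Prop :=
  ∃ (W : Type) (_ : TopologicalSpace W) (_ : T2Space W) (_ : SecondCountableTopology W)
    (_ : ChartedSpace (EuclideanHalfSpace (4 + 1)) W) (_ : IsManifold (𝓡∂ (4 + 1)) ∞ W) (_ : CompactSpace W),
    ContractibleSpace W ∧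
    (∃ f : W → ℝ, Literature.Topology.FourManifolds.IsMorseAdapted (𝓡∂ (4 + 1)) f ∧
      ∀ z, Literature.Topology.FourManifolds.IsMCriticalPt (𝓡∂ (4 + 1)) f z →
        Literature.Topology.FourManifolds.morseIndex (𝓡∂ (4 + 1)) f z ≤ 2) ∧
    ∃ φ : M → W, Manifold.IsSmoothEmbedding (𝓡 4) (𝓡∂ (4 + 1)) ∞ φ ∧ Set.range φ = (𝓡∂ (4 + 1)).boundary W

/-- B (EntropyLadder, stmt-SmoothPoincare4-3720) is literally "every homotopy 4-sphere is `Bounds₂`". -/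
theorem bounds_iff : BoundsContractibleTwoHandlebody ↔
    ∀ (M : Type) [TopologicalSpace M] [T2Space M] [SecondCountableTopology M]
      [ChartedSpace E⁴ M] [IsManifold (𝓡 4) ∞ M], M ≃ₕ 𝕊⁴ → Bounds₂ M := Iff.rfl

/-- T (EntropyLadder, stmt-SmoothPoincare4-3717) is literally "`Bounds₂` homotopy 4-spheres are standard". -/
theorem standard_iff : PresentationSpheresStandard ↔
    ∀ (M : Type) [TopologicalSpace M] [T2Space M] [SecondCountableTopology M]
      [ChartedSpace E⁴ M] [IsManifold (𝓡 4) ∞ M], M ≃ₕ 𝕊⁴ → Bounds₂ M →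
        Nonempty (M ≃ₘ⟮𝓡 4, 𝓡 4⟯ 𝕊⁴) := Iff.rfl

/-! ## §1 The idea's four first lemmas, typed -/

/-- **U₃ = `UpperWidth`** (the idea's "μ(Σ) ≤ √(2π/e) for every homotopy 4-sphere"): every homotopy 4-sphere has,
for every `δ > 0`, an end-separating cross-section embedding with `λ_cyl < √(2π/e) + δ` — the Kervaire–Milnor
h-cobordism `S⁴×I ∪ 2-handles ∪ 3-handles` realised inside `N` with scale-separated thin arches, bubble-sheet
chimneys and `S¹_θ`-tubes over the 3-handle cores, trumpet junctions (triage toys: junction excess ≤ 5·10⁻⁴ once the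
bend radius is ≥ 3 tube radii, k = 1,2,3). SPC4-free, constructive GMT; same statement as ideator-2's `TopRungBound`. -/
def UpperWidth : Prop :=
  ∀ δ : ℝ, 0 < δ → ThinAtLevel (ENNReal.ofReal (Real.sqrt (2 * Real.pi / Real.exp 1) + δ))

/-- **`UpperWidthTwo`**: every homotopy 4-sphere has a cross-section with `λ_cyl < 1.53` (numerical shadow of U₃). -/
def UpperWidthTwo : Prop := ThinAtLevel (ENNReal.ofReal 1.53)

/-- `√(2π/e) < 1.53` (`2π/e < 2.3409`: `π < 3.1416`, `e > 2.7182818283`). -/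
theorem sqrt_two_pi_div_e_lt : Real.sqrt (2 * Real.pi / Real.exp 1) < 1.53 := by
  have he : 2.7182818283 < Real.exp 1 := Real.exp_one_gt_d9
  have hpi : Real.pi < 3.1416 := Real.pi_lt_d4
  have hepos : 0 < Real.exp 1 := Real.exp_pos 1
  have h153 : (1.53 : ℝ) = Real.sqrt 2.3409 := by
    rw [show (2.3409 : ℝ) = 1.53 ^ 2 by norm_num, Real.sqrt_sq (by norm_num)]
  rw [h153]
  apply Real.sqrt_lt_sqrt (by positivity)
  rw [div_lt_iff₀ hepos]
  linarith

/-- U₃ ⇒ `UpperWidthTwo` (take `δ = 1.53 − √(2π/e) > 0`). -/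
theorem upperWidthTwo_of_upperWidth (hU : UpperWidth) : UpperWidthTwo := by
  intro M _ _ _ _ _ e
  set δ : ℝ := 1.53 - Real.sqrt (2 * Real.pi / Real.exp 1) with hδ
  have hδpos : 0 < δ := by rw [hδ]; linarith [sqrt_two_pi_div_e_lt]
  have h := hU δ hδpos M e
  have heq : ENNReal.ofReal (Real.sqrt (2 * Real.pi / Real.exp 1) + δ) = ENNReal.ofReal 1.53 := by
    congr 1; rw [hδ]; ring
  rw [heq] at h
  exact h

/-- **U₂ = `PresentationWidth`** (the idea's "μ(Σ_P) ≤ 4/e for presentation spheres"): a homotopy 4-sphere bounding a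
contractible 5-dimensional 2-handlebody has, for every `δ > 0`, an end-separating cross-section embedding with
`λ_cyl < 4/e + δ` — slice ∪ thin arches `S³_ε×I`, surgered along the relator circles by bubble-sheet chimneys
`D_i × S²_η` (`η ≪ ε`) over disjoint embedded core discs, trumpet junctions; local models slice `1`, necks
`λ(S³×ℝ) = 1.4531`, sheets `λ(S²×ℝ²) = 4/e`, large scales `→ area/|S⁴| = 1 + O(ε³+η²)`. SPC4-free, constructive GMT;
same statement as ideator-2's `ChimneyBound`. The `+ δ` cannot be dropped by this construction (chimneys are
tube-limited at exactly `4/e⁺`, triage toys k = 2). -/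
def PresentationWidth : Prop :=
  ∀ (M : Type) [TopologicalSpace M] [T2Space M] [SecondCountableTopology M]
    [ChartedSpace E⁴ M] [IsManifold (𝓡 4) ∞ M],
    M ≃ₕ 𝕊⁴ → Bounds₂ M → ∀ δ : ℝ, 0 < δ → CrossSectionBelow (ENNReal.ofReal (4 / Real.exp 1 + δ)) M

/-- **`SliceThin`**: a 4-manifold diffeomorphic to `S⁴` has a thin cross-section (the slice transported along the
diffeomorphism; `λ_cyl(slice) = 1 < 4/e` by the support item `SliceCalibration`). -/
def SliceThin : Prop :=
  ∀ (M : Type) [TopologicalSpace M] [ChartedSpace E⁴ M] [IsManifold (𝓡 4) ∞ M],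
    Nonempty (M ≃ₘ⟮𝓡 4, 𝓡 4⟯ 𝕊⁴) → CrossSectionBelow levelTwo M

/-- `1 < 4/e` as typed (`e < 4`). -/
lemma one_lt_levelTwo : (1 : ℝ≥0∞) < levelTwo := by
  rw [levelTwo, ← ENNReal.ofReal_one]
  refine (ENNReal.ofReal_lt_ofReal_iff (by positivity)).mpr ?_
  rw [lt_div_iff₀ (Real.exp_pos 1)]
  have := Real.exp_one_lt_d9
  linarith

/-- The slice `S⁴×{0}` as a set; it is the range of `sliceMap 0`. -/
def slice₀ : Set E⁶ := {z : E⁶ | ∑ i : Fin 5, z (Fin.castSucc i) ^ 2 = 1 ∧ z 5 = 0}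

lemma range_sliceMap_zero : Set.range (sliceMap 0) = slice₀ := range_sliceMap 0

/-- `SliceCalibration` is literally `λ_cyl(slice₀) = 1` for the tree functional. -/
theorem sliceCalibration_iff : SliceCalibration ↔ cylEntropy slice₀ = 1 := Iff.rfl

/-- **`SliceThin` is a theorem given the calibration item** (re-derivation, on tree files only, of the standing
disprover's `crossSectionBelow_of_diffeomorph`; needs `Manifold.IsSmoothEmbedding.comp_diffeomorph` and the slice API). -/
theorem sliceThin_of_calibration (hcal : SliceCalibration) : SliceThin := by
  intro M _ _ _ hM
  obtain ⟨φ⟩ := hM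
  have hr : Set.range (sliceMap 0 ∘ φ) = slice₀ := by
    rw [← range_sliceMap_zero]
    ext z
    simp only [Set.mem_range, Function.comp_apply]
    constructor
    · rintro ⟨x, rfl⟩; exact ⟨φ x, rfl⟩
    · rintro ⟨y, rfl⟩; exact ⟨φ.symm y, by simp⟩
  refine ⟨sliceMap 0 ∘ φ, ?_, ?_, ?_, ?_⟩
  · exact (isSmoothEmbedding_sliceMap 0).comp_diffeomorph φ
  · intro x; exact sum_sq_sliceMap 0 (φ x)
  · rw [hr]
    exact separatesEnds_of_slice_subset (A := slice₀) (c := 0) fun z hz => hz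
  · rw [hr, sliceCalibration_iff.mp hcal]
    exact one_lt_levelTwo

/-! ## §2 The idea's line `E_of` and why it is COSTUME -/

/-- **B ∧ T ⇒ SPC4 in two lines** (every homotopy 4-sphere is a presentation sphere, and those are standard). -/
theorem spc4_of_bounds_of_standard (hB : BoundsContractibleTwoHandlebody) (hT : PresentationSpheresStandard) :
    _root_.SmoothPoincare4 := by
  unfold _root_.SmoothPoincare4 Literature.SPC4.SmoothPoincareConjectureFour
    ContinuousMap.HomotopyEquiv.NonemptyDiffeomorphSphere
  intro M _ _ _ _ _ e
  exact hT M e (hB M e)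

/-- **SPC4 ⇒ E given `SliceThin`** (the standing disprover's `crux_of_spc4`, with the calibration packaged as `SliceThin`). -/
theorem E_of_spc4 (hS : SliceThin) (h : _root_.SmoothPoincare4) : ThinCrossSectionExists := by
  rw [crux_iff]
  intro M _ _ _ _ _ e
  exact hS M (h M ‹ChartedSpace E⁴ M› ‹IsManifold (𝓡 4) ∞ M› e)

/-- **The idea's line** `E_of : B → T → SliceThin → E` (kernel-checked, as advertised in the card's evidence note). -/
theorem E_of (hB : BoundsContractibleTwoHandlebody) (hT : PresentationSpheresStandard) (hS : SliceThin) :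
    ThinCrossSectionExists := by
  rw [crux_iff]
  intro M _ _ _ _ _ e
  exact hS M (hT M e (hB M e))

/-- **COSTUME, kernel-checked**: the line is *definitionally* `crux_of_spc4` precomposed with `B ∧ T ⇒ SPC4` — every use
of `B` and `T` in `E_of` goes through the summit statement. (Both sides are proofs of a `Prop`, so the equation is
also an instance of proof irrelevance; the point is that the right-hand side EXISTS and type-checks: the stubs `B`, `T`
decompose `SmoothPoincare4`, not `E`.) -/
theorem E_of_eq (hB : BoundsContractibleTwoHandlebody) (hT : PresentationSpheresStandard) (hS : SliceThin) :
    E_of hB hT hS = E_of_spc4 hS (spc4_of_bounds_of_standard hB hT) := rfl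

/-- **Against the LANDED negative lemma** (`Theorems/ThinCrossSectionExists/Negative/FrameAnalysis.lean`, p72115): with
`SliceThin` discharged by the calibration item, the idea's line is the tree theorem
`Summit.SmoothPoincare4.SmoothPoincare4.Theorems.ThinCrossSectionExists.Negative.crux_of_spc4 hcal (spc4_of_bounds_of_standard hB hT)`
— the very same term as below with `E_of_spc4 (sliceThin_of_calibration hcal)` in place of `Negative.crux_of_spc4 hcal` (identical
proofs: slice transported along the diffeomorphism). The `Negative.FrameAnalysis` module is not imported here only because it was
not yet built on the farm at check time (`lean check` → remote:stale:unbuilt); the statement below is its in-file twin. -/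
theorem E_of_landed (hB : BoundsContractibleTwoHandlebody) (hT : PresentationSpheresStandard)
    (hcal : SliceCalibration) : ThinCrossSectionExists :=
  E_of_spc4 (sliceThin_of_calibration hcal) (spc4_of_bounds_of_standard hB hT)

/-- Conversely the two SPC4-hard stubs are each CONSEQUENCES of SPC4: T outright … -/
theorem standard_of_spc4 (h : _root_.SmoothPoincare4) : PresentationSpheresStandard := by
  intro M _ _ _ _ _ e _
  exact h M ‹ChartedSpace E⁴ M› ‹IsManifold (𝓡 4) ∞ M› e

/-- … and B given the one model fact "`S⁴` itself is `Bounds₂`" (`D⁵` with the height function; not in the tree, carried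
as the hypothesis `hBall`; `Bounds₂` is transported along a diffeomorphism by precomposing the boundary embedding). -/
theorem bounds_of_spc4 (hBall : Bounds₂ 𝕊⁴) (h : _root_.SmoothPoincare4) : BoundsContractibleTwoHandlebody := by
  intro M _ _ _ _ _ e
  obtain ⟨ψ⟩ := h M ‹ChartedSpace E⁴ M› ‹IsManifold (𝓡 4) ∞ M› e
  obtain ⟨W, i1, i2, i3, i4, i5, i6, hcontr, hMorse, φ, hφ, hrange⟩ := hBall
  refine ⟨W, i1, i2, i3, i4, i5, i6, hcontr, hMorse, φ ∘ ψ, hφ.comp_diffeomorph ψ, ?_⟩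
  rw [← hrange]
  ext w
  simp only [Set.mem_range, Function.comp_apply]
  constructor
  · rintro ⟨x, rfl⟩; exact ⟨ψ x, rfl⟩
  · rintro ⟨y, rfl⟩; exact ⟨ψ.symm y, by simp⟩

/-- So, modulo the model fact, **the stub set {B, T} of the idea's line is EQUIVALENT to `SmoothPoincare4`** — and, given
the route's recognition crux R and the calibration, so is E itself (`Disproof.crux_iff_spc4`): the line re-derives E ⇐ SPC4. -/
theorem bounds_and_standard_iff_spc4 (hBall : Bounds₂ 𝕊⁴) :
    (BoundsContractibleTwoHandlebody ∧ PresentationSpheresStandard) ↔ _root_.SmoothPoincare4 :=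
  ⟨fun h => spc4_of_bounds_of_standard h.1 h.2, fun h => ⟨bounds_of_spc4 hBall h, standard_of_spc4 h⟩⟩

/-! ## §3 The best non-literal skeleton the idea admits, and why it is still T in costume

Replace T by the ENTROPY statement the lever actually approaches: U₂ gives `μ(Σ_P) ≤ 4/e` (every `4/e + δ`), E wants
`< 4/e`; the residue is "the bubble-sheet value is never exactly the infimum". -/

/-- **`NoBubbleSheetValue`**: a homotopy 4-sphere with cross-sections below `4/e + δ` for every `δ > 0` has one below `4/e`
("`μ(Σ) ≤ 4/e ⇒ μ(Σ) < 4/e`": the value `λ(S²×ℝ²)` is not in the spectrum of `μ`). -/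
def NoBubbleSheetValue : Prop :=
  ∀ (M : Type) [TopologicalSpace M] [T2Space M] [SecondCountableTopology M]
    [ChartedSpace E⁴ M] [IsManifold (𝓡 4) ∞ M], M ≃ₕ 𝕊⁴ →
    (∀ δ : ℝ, 0 < δ → CrossSectionBelow (ENNReal.ofReal (4 / Real.exp 1 + δ)) M) → CrossSectionBelow levelTwo M

/-- The three-stub composition `B → U₂ → NoBubbleSheetValue → E` (kernel-checked; NOT registered — see the line card). -/
theorem E_of_presentationWidth (hB : BoundsContractibleTwoHandlebody) (hU : PresentationWidth)
    (hGap : NoBubbleSheetValue) : ThinCrossSectionExists := by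
  rw [crux_iff]
  intro M _ _ _ _ _ e
  exact hGap M e (fun δ hδ => hU M e (hB M e) δ hδ)

/-- **Why `NoBubbleSheetValue` is not a new handle on E**: given the route's recognition crux R (`CylinderRungTwo`,
stmt-7631) and U₂, it IMPLIES `PresentationSpheresStandard` (EntropyLadder's rank-2 crux, the 5-dimensional
Andrews–Curtis problem) — any proof of it produces a cross-section of a presentation sphere strictly below `4/e`, which R
turns into a diffeomorphism with `S⁴`. -/
theorem standard_of_noBubbleSheetValue (hR : CylinderRungTwo) (hU : PresentationWidth) (hGap : NoBubbleSheetValue) :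
    PresentationSpheresStandard := by
  intro M _ _ _ _ _ e hW
  obtain ⟨ι, h1, h2, ⟨R, h3⟩, h4⟩ := hGap M e (fun δ hδ => hU M e hW δ hδ)
  exact hR M e ι h1 h2 ⟨R, h3⟩ h4

/-- … and conversely it FOLLOWS from SPC4 (slice), so it is sandwiched exactly like E: `T ⇐ NoBubbleSheetValue ∧ R ∧ U₂`
and `NoBubbleSheetValue ⇐ SPC4 ∧ SliceCalibration`. No entropy mechanism of the idea separates the two. -/
theorem noBubbleSheetValue_of_spc4 (hcal : SliceCalibration) (h : _root_.SmoothPoincare4) : NoBubbleSheetValue := by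
  intro M _ _ _ _ _ e _
  exact sliceThin_of_calibration hcal M (h M ‹ChartedSpace E⁴ M› ‹IsManifold (𝓡 4) ∞ M› e)

/-! ## §4 What the idea DOES give the route (SPC4-free dictionary, for the disprover and the tenure planner)

Given R: `μ = 1` on `S⁴`, `μ ≥ 4/e` on any exotic sphere (Disproof.mu_dichotomy); U₂ adds `μ ≤ 4/e` on presentation
spheres, U₃ adds `μ ≤ √(2π/e)` on every homotopy sphere — so an exotic presentation sphere would have `μ = 4/e` EXACTLY
(not attained), and E restricted to presentation spheres cannot be met with any margin. Typed consequences: -/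

/-- U₂ + `4/e < √(2π/e)` ⇒ presentation spheres are thin at the NEXT rung (the easy direction `B ⇒ E₃` of the
ladder-split dictionary, here pointwise). -/
theorem crossSectionBelow_levelThree_of_bounds (hU : PresentationWidth)
    (hnum : 4 / Real.exp 1 < Real.sqrt (2 * Real.pi / Real.exp 1))
    {M : Type} [TopologicalSpace M] [T2Space M] [SecondCountableTopology M] [ChartedSpace E⁴ M]
    [IsManifold (𝓡 4) ∞ M] (e : M ≃ₕ 𝕊⁴) (hW : Bounds₂ M) : CrossSectionBelow levelThree M := by
  set δ : ℝ := Real.sqrt (2 * Real.pi / Real.exp 1) - 4 / Real.exp 1 with hδ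
  have hδpos : 0 < δ := by rw [hδ]; linarith
  obtain ⟨ι, h1, h2, h3, h4⟩ := hU M e hW δ hδpos
  refine ⟨ι, h1, h2, h3, ?_⟩
  have : ENNReal.ofReal (4 / Real.exp 1 + δ) = levelThree := by
    rw [levelThree, hδ]; congr 1; ring
  rw [← this]; exact h4

/-- The numerical input `4/e < √(2π/e)` (i.e. `8 < π·e`), proved (as in ideator-2's sketch). -/
theorem four_div_e_lt_sqrt : 4 / Real.exp 1 < Real.sqrt (2 * Real.pi / Real.exp 1) := by
  have he : 2.7182818283 < Real.exp 1 := Real.exp_one_gt_d9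
  have hpi : 3 < Real.pi := Real.pi_gt_three
  have hepos : 0 < Real.exp 1 := Real.exp_pos 1
  have h4pos : 0 ≤ 4 / Real.exp 1 := by positivity
  rw [show 4 / Real.exp 1 = Real.sqrt ((4 / Real.exp 1) ^ 2) by rw [Real.sqrt_sq h4pos]]
  apply Real.sqrt_lt_sqrt (by positivity)
  rw [div_pow, lt_div_iff₀ hepos]
  have : (4 : ℝ) ^ 2 / Real.exp 1 ^ 2 * Real.exp 1 = 16 / Real.exp 1 := by
    field_simp; ring
  rw [this, div_lt_iff₀ hepos]
  nlinarith

/-- B + U₂ ⇒ U₃-at-the-next-rung for EVERY homotopy sphere (so, if B held, `UpperWidth` would be superseded by the sharper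
`ThinAtLevel levelThree`; refuter-facing: a homotopy sphere all of whose cross-sections have `λ_cyl ≥ √(2π/e)` refutes B,
hence SPC4, with a certificate). -/
theorem thinAtLevelThree_of_bounds (hB : BoundsContractibleTwoHandlebody) (hU : PresentationWidth) :
    ThinAtLevel levelThree := by
  intro M _ _ _ _ _ e
  exact crossSectionBelow_levelThree_of_bounds hU four_div_e_lt_sqrt e (hB M e)

end Summit.SmoothPoincare4.SmoothPoincare4.Cruxes.ThinCrossSectionExists.QuantisedWidthReduction

end
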